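import Summits.Ventures.PackingBounds.ThreePointCert.K12d16AggG1
import Summits.Ventures.PackingBounds.ThreePointCert.K12d16AggG2
import Summits.Ventures.PackingBounds.ThreePointCert.K12d16AggP

import Summits.Ventures.PackingBounds.ThreePointCert.K12d16CheckIdS

/-!
# κ(12) ≤ 1356: identity (ii') at the points τ = 30 … 32 of 33 (multi-point Kronecker check `CheckIdKSM.idIIAtF`, file 7 of 7; sequential elaboration)

Framing: lottery ticket; floor = certified bounds/negative ranges. Venture `PackingBounds` (cell
`pub-packcert`), three-point SDP family, kissing column. Integer data / kernel checks of a feasible point of the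
Bachoc–Vallentin semidefinite program (n = 12, s = 1/2, three-point matrix degree 16, two-point (Gegenbauer) part to
degree L = 32, Bachoc–Vallentin multiplier set = cell mode sym2; exact rational certificate `sdp-n12-d16-s1-2-sym2-a32-hyb8dd-j161062.json`
(sha256 3538917063cb882814eff01c8d1f1bd6262b8598d353925bdca5ccaa1b08c098) of the sdp seat's hybrid pipeline, verified by the cell's two exact verifiers), converted by
`cert2lean_g9.py` (lp gen 9; S = 74) into the units of the kernel checker `ThreePointCert.Check` + `CheckSym2` with the
record degree field set to L = 32 (the checker's degree enters only the unit `W = 2^d·d!` and the side conditions, so a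
(d, L) certificate is a `Cert3` of degree L); symmetry-adapted PARTS (S₃/S₂ isotypic bases of short polynomials) with coarse factor COLUMNS, validated by
Kronecker substitution `ThreePointCert.CheckKSP` (`sosCheckKSParts`: the claimed expansion and `Σ_parts Σ_k col_k²` compared at `(2^w, 2^{wD}, 2^{wD²})`); three-point part by `CheckFKS`;
split check of (ii') `ThreePointCert.CheckSym2Split`. Emitter `emitlean_ks3.py` (lp gen 10; expansions `4^k • Σ_parts pᵀ(L′L′ᵀ)p` lifted by `SoundNN.boxNonneg_smul`). Generated file: plain lists of integers / monomials.
-/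


namespace Summit.Ventures.PackingBounds.ThreePointCert.K12d16

open Literature.Geometry.DiscreteGeometry Literature.Geometry.DiscreteGeometry.PolyCert PolyCert.SPoly

/- sequential elaboration: one point at a time (kernel memory) -/
set_option Elab.async false

set_option maxRecDepth 100000 in
set_option maxHeartbeats 0 in
/-- Identity `(ii')` at `(2^511, 2^(511·33), 30)`: `qII = 0` there, from the flat leaves (grouped evaluation, numbers of 511·33² bits; kernel). -/
theorem pII_30 : idIIAtF 511 33 30 K12d16.cert FPc E0c E1c E2c E3c E4c RHc K12d16.cR0 K12d16.cR1 K12d16.cR2 K12d16.cR3 K12d16.cR4 = true := by decide +kernel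

set_option maxRecDepth 100000 in
set_option maxHeartbeats 0 in
/-- Identity `(ii')` at `(2^511, 2^(511·33), 31)`: `qII = 0` there, from the flat leaves (grouped evaluation, numbers of 511·33² bits; kernel). -/
theorem pII_31 : idIIAtF 511 33 31 K12d16.cert FPc E0c E1c E2c E3c E4c RHc K12d16.cR0 K12d16.cR1 K12d16.cR2 K12d16.cR3 K12d16.cR4 = true := by decide +kernel

set_option maxRecDepth 100000 in
set_option maxHeartbeats 0 in
/-- Identity `(ii')` at `(2^511, 2^(511·33), 32)`: `qII = 0` there, from the flat leaves (grouped evaluation, numbers of 511·33² bits; kernel). -/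
theorem pII_32 : idIIAtF 511 33 32 K12d16.cert FPc E0c E1c E2c E3c E4c RHc K12d16.cR0 K12d16.cR1 K12d16.cR2 K12d16.cR3 K12d16.cR4 = true := by decide +kernel

end Summit.Ventures.PackingBounds.ThreePointCert.K12d16
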